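import Literature.Barriers.ResolutionOfSingularities.DimensionFourFrontier
import Literature.AlgebraicGeometry.Resolution.ArithmeticalThreefoldsLocal
import Literature.AlgebraicGeometry.Resolution.LUCompleteChar0TrustBase
import HarnessLib

/-!
# Cossart–Piltant's dimension-`3` architecture one dimension up: the dimension-`4` chain, typed

Topic: `Literature/AlgebraicGeometry/CossartPiltant2008to2019` — typed skeleton of PUBLISHED work
(V. Cossart, O. Piltant, *Resolution of singularities of threefolds in positive characteristic
I, II*, J. Algebra 320 (2008) 1051–1082 and 321 (2009) 1836–1976; *Resolution of singularities
of arithmetical threefolds*, J. Algebra 529 (2019) 268–535 = arXiv:1412.0868, "… Arithmetical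
Threefolds II"), written for the dimension-`4` obstruction census of the cell `pub-hironaka`
(unit `b2b-hironaka-cp4`, `OBSTRUCTIONS-DIM4.md`). What is reproduced: NOT a theorem of the
sources — the sources prove dimension `3` — but their PROOF ARCHITECTURE with `3 ↦ n`, every
node being the tree's audited dimension-`3` node (`ArithmeticalThreefolds.lean`,
`ArithmeticalThreefoldsLocal.lean`) with the literal `3` replaced by a parameter `n`, and
identified with it at `n = 3` (`…_three_iff`, all by unfolding). Nothing here is asserted: the
dimension-`n` nodes are `Prop`-valued predicates in `n`; the theorems are the bookkeeping
implications between them, proved by pure logic, plus ONE node proved outright for every `n`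
(the residue-characteristic-zero leaf, from the tree's named fact `Hironaka1964_local`).

## The printed architecture (arXiv v1 numbering; journal = v2 numbers in the cite tags)

Cossart–Piltant 2019 prove Thm. 1.1 (resolution of reduced separated quasi-excellent Noetherian
schemes of dimension `≤ 3`) as: Thm. 1.4 (the LOCAL theorem for `h = X^p + f₁X^{p-1} + ⋯ + f_p`
over an excellent regular local ring `S` of dimension `n = 3`, Chapters 5–9) ⟹ (Prop. 4.8,
§4.2: Cohen structure, reduction to cyclic coverings of degree `p`, Galois approximation)
(LU) for complete local domains of dimension `3` ⟹ (Prop. 4.6: rank-one reduction [NSp],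
algebraization, descent) (LU) ⟹ (Prop. 4.4, Zariski patching, with resolution of surfaces)
Thm. 1.1. The sources print where dimension `3` is used: "Beginning from chapter 4, dimension
`n = 3` is assumed" (§1); Chapters 2–3 (the invariant `ι = (m, ω, κ)`, permissible blowing ups,
non-increase of `ι`) are written "in any dimension `n := dim S ≥ 1`", §3.3 being "intended to
serve as a guideline for `n ≥ 4`" (§1); Chapter 5 opens: "In this section, we perform induction
on the dimension `dim S[Z] = 4` of the ambient space of `𝒳` … This step is for now far out of
reach in higher dimensions and little more than definitions could be stated"; §1.1 (ii)–(iii):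
"a casuistic analysis which seems for the moment out of reach in higher dimensions".
[CossartPiltant2019]

## Content

* `LocalTheoremInDim n`, `ReductionPInDim n`, `LUCompleteChar0InDim n`, `LUCompleteInDim n`,
  `LUOfCompleteInDim n` — the tree's `CossartPiltant2019Local`, `CossartPiltant2019ReductionP`,
  `CossartPiltant2019LUCompleteChar0`, `CossartPiltant2019LUComplete3`,
  `CossartPiltant2019LU3OfComplete` with `3 ↦ n` (for the last one the conclusion
  `CossartPiltant2019LU3 = ∀ k, LocalUniformization3 k` becomes the barrier catalogue's
  `∀ k, LocalUniformizationUpToDim k n`); `…_three_iff` — at `n = 3` each IS the tree node.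
* PROVED for every `n`: `luCompleteChar0InDim_of_hironaka1964_local` (the characteristic-zero
  leaf, from `Hironaka1964_local` via the tree's dimension-free
  `Hironaka1964_local.cpLocalUniformization_of_isAdicComplete`); the assemblies
  `LUCompleteInDim.of_local` (dichotomy on the residue characteristic, as the tree's
  `CossartPiltant2019LUComplete3.of_local`), `lu_upToDim_of_chain`,
  `resolution_upToDim_four_of_chain` (with the barrier's `ZariskiPatchingUpToDim 4` and the
  tree's `CossartPiltant2019`), `resolution_all_of_chains` (every dimension, by the barrier's
  induction `resolutionOverUpToDim_all_of_patching`), and the `n = 3` sanity check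
  `cossartPiltant2019_of_chain_three` (at `n = 3` the chain is the tree's own assembly).
* For the census: the dimension-`4` trust base of Cossart–Piltant's road to resolution up to
  dimension `4` is exactly {`LocalTheoremInDim 4` (= census O4/O5, "far out of reach"),
  `ReductionPInDim 4` (= O3, whose printed proof consumes embedded resolution in regular
  threefolds ↦ fourfolds, O1), `LUOfCompleteInDim 4` (descent; consumes O1 at the printed level),
  `ZariskiPatchingUpToDim 4` (= O2, "never been extended to dimensions higher than three"),
  `Hironaka1964_local`, `CossartPiltant2019`} — `resolution_upToDim_four_of_chain`.

## What is deliberately NOT here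

No blow-ups, characteristic polyhedra, `ω`, `κ` or Hironaka-permissibility (absent from Mathlib;
the local theorem is vendored, as in the tree, by its weak local-uniformization conclusion); no
claim that any `…InDim 4` holds or fails; the embedded input ELU₄ (Cutkosky–Mourtada) and the
push-down problem (Cossart–Piltant I, Problem 9.1) are separate files of this directory.
-/

noncomputable section

open IsLocalRing Polynomial

namespace Literature.AlgebraicGeometry.CossartPiltant2008to2019

open Literature.AlgebraicGeometry.Resolution Literature.Barriers.ResolutionOfSingularities

universe u

/-! ## The nodes of Chapter 4 – 5 with `3 ↦ n` -/

/-- **Cossart–Piltant's local theorem in ambient dimension `n`** — the tree's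
`CossartPiltant2019Local` (journal Thm. 1.5 = arXiv v1 Thm. 1.4, weak local-uniformization
form, case `h` irreducible: `S` an excellent regular local domain of Krull dimension `3` with
residue characteristic `p`, `h ∈ S[X]` monic of degree `p` irreducible over `K = Frac S`,
`L = K(x)`, (i) `char K = p` and `h = X^p + f_p` or (ii) `Aut_K(L)` of order `p` stabilising
`S[x]`; every valuation ring of `L` containing `S` and centred in `m_S` is uniformized by some
`S[x][t]`) with `dim S = 3` replaced by `dim S = n`. PRINTED AND PROVED for `n = 3` only
(`localTheoremInDim_three_iff`); for `n = 4` it is the step the authors call "for now far out of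
reach in higher dimensions" (Ch. 5, opening) — an open input of the dimension-`4` census, a
predicate in `n` asserted nowhere. [cite: CossartPiltant2019, Thm. 1.5 (arXiv v1: Thm. 1.4), with 3 ↦ n] -/
def LocalTheoremInDim (n : ℕ) : Prop :=
  ∀ (p : ℕ), p.Prime →
  ∀ (S : Type u) [CommRing S] [IsDomain S] [IsRegularLocalRing S],
    IsExcellentRing S → ringKrullDim S = n → CharP (ResidueField S) p →
  ∀ (K : Type u) [Field K] [Algebra S K] [IsFractionRing S K]
    (L : Type u) [Field L] [Algebra K L] [Algebra S L] [IsScalarTower S K L]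
    (h : S[X]) (x : L),
    h.Monic → h.natDegree = p → Irreducible (h.map (algebraMap S K)) → aeval x h = 0 →
    Algebra.adjoin K ({x} : Set L) = ⊤ →
    ((CharP K p ∧ ∀ i, 0 < i → i < p → h.coeff i = 0) ∨
      (Nat.card (L ≃ₐ[K] L) = p ∧
        ∀ σ : L ≃ₐ[K] L, ∀ y ∈ Algebra.adjoin S ({x} : Set L),
          σ y ∈ Algebra.adjoin S ({x} : Set L))) →
  ∀ (O : ValuationSubring L), (∀ s : S, algebraMap S L s ∈ O) →
    (∀ s ∈ maximalIdeal S, O.valuation (algebraMap S L s) < 1) →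
    ∃ (t : Finset L) (ht : (Algebra.adjoin S (insert x (t : Set L))).toSubring ≤ O.toSubring),
      IsRegularLocalRing (Localization.AtPrime
        (Ideal.comap (Subring.inclusion ht) (maximalIdeal O)))

/-- **The reduction of (LU) for complete local domains of dimension `n` to the local theorem in
dimension `n`** — the tree's `CossartPiltant2019ReductionP` (journal Prop. 4.10 = v1 Prop. 4.8,
residue characteristic `p > 0`: Cohen structure, reduction to cyclic degree-`p` coverings,
Galois approximation journal Prop. 4.13, principalization journal Prop. 4.4, [CoP1] Cor. 7.3,
Props. 6.3, 9.1, 9.3) with `3 ↦ n`. PRINTED AND PROVED for `n = 3`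
(`reductionPInDim_three_iff`); the printed proof uses principalization / embedded resolution
in excellent regular THREEFOLDS, whose fourfold analogue is the census input O1.
[cite: CossartPiltant2019, proof of Prop. 4.10 (arXiv v1: Prop. 4.8), §4.2, with 3 ↦ n] -/
def ReductionPInDim (n : ℕ) : Prop :=
  LocalTheoremInDim.{u} n →
    ∀ (p : ℕ), p.Prime →
    ∀ (A : Type u) [CommRing A] [IsDomain A] [IsLocalRing A] [IsNoetherianRing A]
      [IsAdicComplete (maximalIdeal A) A],
      ringKrullDim A = n → CharP (ResidueField A) p → CPLocalUniformization A

/-- **(LU) for complete Noetherian local domains of dimension `n` and residue characteristic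
zero** — the tree's `CossartPiltant2019LUCompleteChar0` ("the equicharacteristic zero version
of theorem 1.1 being known") with `3 ↦ n`. Unlike the other nodes this one is a THEOREM for
every `n` modulo Hironaka (`luCompleteChar0InDim_of_hironaka1964_local`).
[cite: CossartPiltant2019, proof of Prop. 4.10 (arXiv v1: Prop. 4.8), first paragraph, with 3 ↦ n] -/
def LUCompleteChar0InDim (n : ℕ) : Prop :=
  ∀ (A : Type u) [CommRing A] [IsDomain A] [IsLocalRing A] [IsNoetherianRing A]
    [IsAdicComplete (maximalIdeal A) A],
    ringKrullDim A = n → CharZero (ResidueField A) → CPLocalUniformization A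

/-- **(LU) for complete Noetherian local domains of dimension `n`** — the tree's
`CossartPiltant2019LUComplete3` ("it is sufficient to prove that (LU) holds for every complete
local domain `(A,m,k)` of dimension three") with `3 ↦ n`.
[cite: CossartPiltant2019, Cor. 1.2 and proof of Prop. 4.10 (arXiv v1: Prop. 4.8), with 3 ↦ n] -/
def LUCompleteInDim (n : ℕ) : Prop :=
  ∀ (A : Type u) [CommRing A] [IsDomain A] [IsLocalRing A] [IsNoetherianRing A]
    [IsAdicComplete (maximalIdeal A) A], ringKrullDim A = n → CPLocalUniformization A

/-- **Descent of (LU) from complete local domains, dimension `n`** — the tree's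
`CossartPiltant2019LU3OfComplete` (journal Prop. 4.8 = v1 Prop. 4.6: rank-one reduction
[NSp] Thm. 1.1 "valid in all dimensions", algebraization, Lemma 4.7 with embedded resolution of
surfaces, [CoP1] Prop. 9.1) with `3 ↦ n`: (LU) for complete local domains of dimension `n`
gives local uniformization up to dimension `n` over every field (the barrier catalogue's
`LocalUniformizationUpToDim k n`; at `n = 3` literally `CossartPiltant2019LU3`,
`luOfCompleteInDim_three_iff`). [cite: CossartPiltant2019, Prop. 4.8 (arXiv v1: Prop. 4.6), with 3 ↦ n] -/
def LUOfCompleteInDim (n : ℕ) : Prop :=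
  LUCompleteInDim.{u} n → ∀ (k : Type u) [Field k], LocalUniformizationUpToDim k n

/-! ## At `n = 3` the nodes are the tree's nodes -/

/-- `LocalTheoremInDim 3` is, verbatim, the tree's `CossartPiltant2019Local`. [folklore] -/
theorem localTheoremInDim_three_iff : LocalTheoremInDim.{u} 3 ↔ CossartPiltant2019Local.{u} := by
  simp only [LocalTheoremInDim, CossartPiltant2019Local, Nat.cast_ofNat]

/-- `LUCompleteChar0InDim 3` is the tree's `CossartPiltant2019LUCompleteChar0`. [folklore] -/
theorem luCompleteChar0InDim_three_iff :
    LUCompleteChar0InDim.{u} 3 ↔ CossartPiltant2019LUCompleteChar0.{u} := by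
  simp only [LUCompleteChar0InDim, CossartPiltant2019LUCompleteChar0, Nat.cast_ofNat]

/-- `LUCompleteInDim 3` is the tree's `CossartPiltant2019LUComplete3`. [folklore] -/
theorem luCompleteInDim_three_iff :
    LUCompleteInDim.{u} 3 ↔ CossartPiltant2019LUComplete3.{u} := by
  simp only [LUCompleteInDim, CossartPiltant2019LUComplete3, Nat.cast_ofNat]

/-- `ReductionPInDim 3` is the tree's `CossartPiltant2019ReductionP`. [folklore] -/
theorem reductionPInDim_three_iff :
    ReductionPInDim.{u} 3 ↔ CossartPiltant2019ReductionP.{u} := by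
  simp only [ReductionPInDim, CossartPiltant2019ReductionP, localTheoremInDim_three_iff,
    Nat.cast_ofNat]

/-- `LUOfCompleteInDim 3` is the tree's `CossartPiltant2019LU3OfComplete`. [folklore] -/
theorem luOfCompleteInDim_three_iff :
    LUOfCompleteInDim.{u} 3 ↔ CossartPiltant2019LU3OfComplete.{u} := by
  simp only [LUOfCompleteInDim, CossartPiltant2019LU3OfComplete, luCompleteInDim_three_iff,
    CossartPiltant2019LU3, localUniformizationUpToDim_three_iff]

/-! ## Bookkeeping (proved for every `n`) -/

/-- **The residue-characteristic-zero leaf holds in every dimension, modulo Hironaka**: a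
complete Noetherian local domain is excellent (`Stacks07QW_complete_holds`, proved in the
tree), so Hironaka's theorem over local quasi-excellent rings of residue characteristic zero
(the named fact `Hironaka1964_local`) gives (LU) — the tree's dimension-free
`Hironaka1964_local.cpLocalUniformization_of_isAdicComplete`.
[cite: CossartPiltant2019, proof of Prop. 4.10 (arXiv v1: Prop. 4.8), first paragraph] -/
theorem luCompleteChar0InDim_of_hironaka1964_local (hH : Hironaka1964_local.{u}) (n : ℕ) :
    LUCompleteChar0InDim.{u} n :=
  fun A _ _ _ _ _ _ h0 => hH.cpLocalUniformization_of_isAdicComplete A h0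

/-- **Assembly in dimension `n`** (shape of journal Prop. 4.10): the local theorem, the
reduction and the residue-characteristic-zero leaf give (LU) for complete local domains of
dimension `n` — dichotomy on the residue characteristic, as the tree's
`CossartPiltant2019LUComplete3.of_local`.
[cite: CossartPiltant2019, proof of Prop. 4.10 (arXiv v1: Prop. 4.8), with 3 ↦ n] -/
theorem LUCompleteInDim.of_local {n : ℕ} (hloc : LocalTheoremInDim.{u} n)
    (hred : ReductionPInDim.{u} n) (h0 : LUCompleteChar0InDim.{u} n) : LUCompleteInDim.{u} n := by
  intro A _ _ _ _ _ hdim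
  obtain ⟨p, hp⟩ := CharP.exists (ResidueField A)
  rcases CharP.char_is_prime_or_zero (ResidueField A) p with hprime | rfl
  · exact hred hloc p hprime A hdim hp
  · haveI := hp
    haveI : CharZero (ResidueField A) := CharP.charP_to_charZero (ResidueField A)
    exact h0 A hdim ‹_›

/-- **The local half of the chain in dimension `n`**: local theorem, reduction, Hironaka's
characteristic-zero leaf and descent give local uniformization up to dimension `n` over every
field. [cite: CossartPiltant2019, Ch. 4 (Props. 4.8, 4.10 of the journal version), with 3 ↦ n] -/
theorem lu_upToDim_of_chain {n : ℕ} (hloc : LocalTheoremInDim.{u} n)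
    (hred : ReductionPInDim.{u} n) (hH : Hironaka1964_local.{u}) (hdesc : LUOfCompleteInDim.{u} n) :
    ∀ (k : Type u) [Field k], LocalUniformizationUpToDim k n :=
  hdesc (LUCompleteInDim.of_local hloc hred (luCompleteChar0InDim_of_hironaka1964_local hH n))

/-- **Cossart–Piltant's road to dimension `4`, typed.** Over the tree's `CossartPiltant2019`
(resolution up to dimension `3` over every field) and `Hironaka1964_local`, weak resolution of
reduced separated schemes of finite type of dimension `≤ 4` over every field follows from the
four dimension-`4` inputs `LocalTheoremInDim 4`, `ReductionPInDim 4`, `LUOfCompleteInDim 4` and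
the barrier catalogue's `ZariskiPatchingUpToDim 4` — each printed as open or as restricted to
dimension three ("far out of reach in higher dimensions", Ch. 5; "the Patching Theorem has
never been extended to dimensions higher than three", Piltant 2013, §1). The theorem is the
DAG; no hypothesis is asserted. [cite: CossartPiltant2019, §1.1 and Ch. 4–5 (architecture)]
[cite: Piltant2013, §1 (Introduction)] -/
theorem resolution_upToDim_four_of_chain (h3 : CossartPiltant2019.{u}) (hH : Hironaka1964_local.{u})
    (hloc : LocalTheoremInDim.{u} 4) (hred : ReductionPInDim.{u} 4) (hdesc : LUOfCompleteInDim.{u} 4)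
    (hP4 : ZariskiPatchingUpToDim.{u} 4) :
    ∀ (k : Type u) [Field k], ResolutionOverUpToDim k 4 :=
  DimensionFourFrontier.of_cossartPiltant2019 h3 (lu_upToDim_of_chain hloc hred hH hdesc) hP4

/-- **The same road in every dimension**: resolution of surfaces (`CossartJannsenSaito2020`),
Hironaka's characteristic-zero leaf, and — for every `n ≥ 3` — the local theorem, the
reduction, the descent and Zariski patching in dimension `n` give weak resolution in every
dimension over every field (the barrier's induction `resolutionOverUpToDim_all_of_patching`;
local uniformization in dimension `≤ 2` is the case `n = 3` by monotonicity).
[cite: CossartPiltant2019, §1.1 and Ch. 4–5 (architecture), with 3 ↦ n] -/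
theorem resolution_all_of_chains (hCJS : CossartJannsenSaito2020.{u}) (hH : Hironaka1964_local.{u})
    (hchain : ∀ n, 3 ≤ n → LocalTheoremInDim.{u} n ∧ ReductionPInDim.{u} n ∧
      LUOfCompleteInDim.{u} n ∧ ZariskiPatchingUpToDim.{u} n) :
    ∀ (k : Type u) [Field k] (n : ℕ), ResolutionOverUpToDim k n := by
  have hLU : ∀ (k : Type u) [Field k] (n : ℕ), 3 ≤ n → LocalUniformizationUpToDim k n :=
    fun k _ n hn =>
      let ⟨hloc, hred, hdesc, _⟩ := hchain n hn
      lu_upToDim_of_chain hloc hred hH hdesc k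
  refine resolutionOverUpToDim_all_of_patching hCJS ?_ fun n hn => (hchain n hn).2.2.2
  intro k _ n
  rcases Nat.lt_or_ge n 3 with hlt | hge
  · exact (hLU k 3 le_rfl).mono hlt.le
  · exact hLU k n hge

/-- **Sanity (`n = 3`): the chain at `n = 3` is the tree's own assembly of
`CossartPiltant2019`** (`cossartPiltant2019_of_local'''` with the descent node in the
`LocalUniformizationUpToDim` spelling), so the parametrisation is faithful where the sources
prove something. [cite: CossartPiltant2019, Ch. 4] -/
theorem cossartPiltant2019_of_chain_three (hloc : LocalTheoremInDim.{u} 3)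
    (hred : ReductionPInDim.{u} 3) (hH : Hironaka1964_local.{u}) (hdesc : LUOfCompleteInDim.{u} 3)
    (hCJS : CossartJannsenSaito2020.{u}) (hP : CossartPiltant2019Patching.{u}) :
    CossartPiltant2019.{u} :=
  cossartPiltant2019_of_patching hCJS
    (cossartPiltant2019LU3_iff.mpr (lu_upToDim_of_chain hloc hred hH hdesc)) hP

/-- Conversely the tree's dimension-`3` leaves give the `n = 3` chain inputs (all four
identifications at once). [folklore] -/
theorem chain_three_of_tree (hloc : CossartPiltant2019Local.{u}) (hred : CossartPiltant2019ReductionP.{u})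
    (hdesc : CossartPiltant2019LU3OfComplete.{u}) :
    LocalTheoremInDim.{u} 3 ∧ ReductionPInDim.{u} 3 ∧ LUOfCompleteInDim.{u} 3 :=
  ⟨localTheoremInDim_three_iff.mpr hloc, reductionPInDim_three_iff.mpr hred,
    luOfCompleteInDim_three_iff.mpr hdesc⟩

end Literature.AlgebraicGeometry.CossartPiltant2008to2019

end
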